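import Literature.NumberTheory.Automorphic.PairLFunctionPolesRankNeLandau
import Literature.NumberTheory.Automorphic.PairLFunctionPolesRankNeOneFamily
import Literature.NumberTheory.Automorphic.PairLFunctionMeromorphicContinuationProofs
import Literature.NumberTheory.Automorphic.LanglandsTunnellBridgeL2
import Literature.NumberTheory.Automorphic.GodementJacquetPartialLHolds
import HarnessLib

/-!
# Arthur–Clozel (2.2) at `s = 1` for `GL_n × GL_1` and `GL_1 × GL_n` from Godement–Jacquet and
# Mœglin–Waldspurger (ii) at `GL_n`

Topic `NumberTheory/Automorphic`; namespace `Literature.NumberTheory.Automorphic`. Proof file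
(theorems only: no definition, no named fact, no instance) under the named fact
`JacquetShalika1981_partialPairL_at_one_of_rank_ne` of `PairLFunctionPoles` — Arthur–Clozel,
*Simple algebras, base change, and the advanced theory of the trace formula*, Ann. of Math.
Stud. 120 (1989), Ch. 3 §2, (2.2), p. 171, at `s₀ = 1`, `n ≠ m` — in the ranks `(n, 1)` and
`(1, n)`.

`PairLFunctionPolesRankNeLandau` proves the fact in every pair of ranks from the two
Mœglin–Waldspurger continuation facts, Corollaire (i)(a) (`L^S(s, π ⊗ σ)` entire, `n ≠ m`) and
Corollaire (ii) (`s (s - 1) L^S(s, π ⊗ π̃)` entire) at rank `n` and at rank `m`, by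
de la Vallée Poussin's positivity argument with Landau's lemma
(`partialPairL_continuation_apply_one_ne_zero`). For a pair `(π, χ)` with `χ` a character of
`GL_1` two of these three inputs are now theorems or nearly so:

* Corollaire (ii) at rank `1` is a theorem of the tree
  (`MoeglinWaldspurger1989_partialPairL_of_eq_conj_one`: `s (s - 1) ζ_K^S(s)` is entire, Hecke);
* Corollaire (i)(a) for `(π, χ)` is Godement–Jacquet: `L^S(s, π ⊗ χ) = L^S(s, π ⊗ χ)` is the
  partial *standard* `L`-function of the cuspidal twist `π ⊗ χ` of `GL_n`
  (`partialPairL_eq_partialStandardL_twist`, `IsSatakeFamilyOf.twistByChar`; Arthur–Clozel, Ch. 3,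
  p. 172: "`t_{π ⊗ χ, v} = χ(ϖ_v) t_{π, v}`"), entire for `n ≥ 2` by Godement–Jacquet, LNM 260,
  Thm. 13.8 — in the tree the named fact `godementJacquet` (`AutomorphicLFunctions`, lang.S21).

So this file proves:

* `exists_entire_eq_partialStandardL_of_godementJacquet` — **`godementJacquet` at `GL_n`, `n ≥ 2`,
  in partial-`L` form at every finite `S`:** for cuspidal `Π`, finite `S` and an honest Satake
  family `γ` of `Π` off `S`, `L^S(s, Π)` agrees on `Re s > 1` with an entire function (the datum
  `D` of `godementJacquet Π` has `D.S` = the ramified places `⊆ S` and `D.α = γ` off `S` by the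
  uniqueness of Satake parameters, `IsSatakeFamilyOf.eq_of_not_mem`; then
  `StandardLFunctionData.exists_entire_eq_partialStandardL_of_hasEntireContinuation` far to the
  right and the identity theorem on `Re s > 1`, where `L^S(s, Π)` is holomorphic by
  Jacquet–Shalika's Thm. (5.3), `JacquetShalika1981_differentiableOn_partialStandardL_holds`);
* `exists_entire_one_family_partialPairL_of_entire_standard` — from that entire-standard
  statement at `GL_n`: every pair `(π, χ)`, `π` cuspidal on `GL_n`, `χ` on `GL_1`, has a finite
  `S₀` and Satake families `α₀`, `β₀` off `S₀` with `L^{S₀}(s, α₀ ⊗ β₀)` agreeing on `Re s > 1`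
  with an entire function (Corollaire (i)(a) for the pair, one-family form);
* `JacquetShalika1981_partialPairL_at_one_of_rank_ne_of_entire_standard_of_MW` (and `…_left…`) —
  **the named fact for `(n, 1)` (and `(1, n)`) from the entire-standard statement at `GL_n` and
  Corollaire (ii) at `GL_n` only**: the datum's entire continuation `E` has `E(1) ≠ 0` by
  `partialPairL_continuation_apply_one_ne_zero` (Corollaire (ii) at rank `1` being a theorem), and
  for `m = 1 ≤ 2` the fact is its one-family datum
  (`JacquetShalika1981_partialPairL_at_one_of_rank_ne_of_one_family_of_le_two_right`);
* `JacquetShalika1981_partialPairL_at_one_of_rank_ne_and_left_of_godementJacquet_of_MW` —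
  **`GL_n × GL_1` and `GL_1 × GL_n`, `n ≥ 2`, from the named facts `godementJacquet` at `GL_n` and
  `MoeglinWaldspurger1989_partialPairL_of_eq_conj` at `GL_n`, nothing else.** Compared with
  `JacquetShalika1981_partialPairL_at_one_of_rank_ne_and_left_of_godementJacquet_of_nonvanishing`
  (`PairLFunctionPolesRankNeOneFamily`), the non-vanishing hypothesis `L(1, Π) ≠ 0`
  (Jacquet–Shalika 1976) is replaced by Corollaire (ii) at `GL_n` through the positivity argument.

## References

* J. Arthur, L. Clozel, *Simple algebras, base change, and the advanced theory of the trace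
  formula*, Ann. of Math. Stud. 120 (1989), Ch. 3 §2, (2.2), p. 171; p. 172. [ArthurClozelAMS120]
* C. Mœglin, J.-L. Waldspurger, *Le spectre résiduel de `GL(n)`*, Ann. Sci. ÉNS (4) 22 (1989),
  Appendice, Corollaire, p. 667. [MoeglinWaldspurger1989]
* R. Godement, H. Jacquet, *Zeta functions of simple algebras*, LNM 260 (1972), Thm. 13.8.
  [GodementJacquet1972]
* S. Gelbart, *When is an `L`-function non-vanishing in part of the critical strip?* (2007), §2.
  [Gelbart2007Nonvanishing]
* H. Jacquet, J. A. Shalika, *On Euler products and the classification of automorphic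
  representations I*, Amer. J. Math. 103 (1981), Thm. (5.3). [JacquetShalikaAJM1981]
-/

noncomputable section

open scoped Topology
open NumberField IsDedekindDomain MeasureTheory Filter Complex

namespace Literature.NumberTheory.Automorphic

open AdelicGroupData

/-! ### Godement–Jacquet in partial-`L` form at every finite `S` -/

section Standard

variable {n : ℕ} {K : Type} [Field K] [NumberField K]
  {μ : Measure (gl n K).automorphicQuotient} [(gl n K).IsAutomorphicMeasure μ]

/-- **`L^S(s, Π)` is entire, from `godementJacquet` (`n ≥ 2`).** For a cuspidal `Π` of
`GL_n(𝔸_K)`, `n ≥ 2`, a finite set `S` of finite places and an honest Satake family `γ` of `Π` off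
`S`, the partial standard `L`-function `L^S(s, Π) = partialStandardL S γ` agrees on `Re s > 1` with
an entire function: the datum `D` of `godementJacquet Π` has entire `D.L`, its exceptional set
`D.S` is the set of ramified places of `Π` (`StandardLFunctionData.mem_S_iff`), contained in `S`
(`IsSatakeFamilyOf.isUnramifiedAt`), and `D.α = γ` off `S` (`IsSatakeFamilyOf.eq_of_not_mem`), so
`StandardLFunctionData.exists_entire_eq_partialStandardL_of_hasEntireContinuation` gives an entire
`g = L^S(s, Π)` far to the right, whence on `Re s > 1` by the identity theorem
(`eqOn_halfPlane_of_eqOn_right`; `L^S(s, Π)` is holomorphic there by Jacquet–Shalika's Thm. (5.3),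
`JacquetShalika1981_differentiableOn_partialStandardL_holds`). (Godement–Jacquet, Thm. 13.8 with
Thm. 3.3: `L^S(s, π) = L(s, π) ∏_{v ∈ S} L(s, π_v)⁻¹` is entire with `L(s, π)`.)
[cite: GodementJacquet1972, Thm. 13.8] -/
theorem exists_entire_eq_partialStandardL_of_godementJacquet (hn : 2 ≤ n)
    (hGJ : godementJacquet (n := n) (K := K) (μ := μ)) (Q : CuspidalAutomorphicRepGL n K μ)
    {S : Set (HeightOneSpectrum (𝓞 K))} (hS : S.Finite) {γ : SatakeFamily K}
    (hγ : IsSatakeFamilyOf Q S γ) :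
    ∃ g : ℂ → ℂ, Differentiable ℂ g ∧ ∀ s : ℂ, 1 < s.re → g s = partialStandardL S γ s := by
  classical
  lift S to Finset (HeightOneSpectrum (𝓞 K)) using hS
  obtain ⟨D, hD, -⟩ := hGJ Q (Or.inl hn)
  have hDS : D.S ⊆ S := by
    intro v hv
    by_contra hvS
    exact (D.mem_S_iff.mp hv) (hγ.isUnramifiedAt (by exact_mod_cast hvS))
  have hγD : ∀ v ∉ S, γ v = D.α v := by
    intro v hv
    exact hγ.eq_of_not_mem D.isSatakeFamily (by exact_mod_cast hv)
      (fun h => hv (hDS (by exact_mod_cast h)))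
  obtain ⟨g, hg, x₀, hgeq⟩ :=
    D.exists_entire_eq_partialStandardL_of_hasEntireContinuation hD hDS hγD
  refine ⟨g, hg, ?_⟩
  exact eqOn_halfPlane_of_eqOn_right hg
    (JacquetShalika1981_differentiableOn_partialStandardL_holds Q S γ hγ) (le_max_right x₀ 1)
    (fun s hs => hgeq s ((le_max_left _ _).trans_lt hs))

end Standard

/-! ### The entire one-family datum of a pair `(π, χ)` from the entire-standard statement -/

section Datum

variable {n : ℕ} {K : Type} [Field K] [NumberField K]
  {μ : Measure (gl n K).automorphicQuotient} [(gl n K).IsAutomorphicMeasure μ]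
  {μ₁ : Measure (gl 1 K).automorphicQuotient} [(gl 1 K).IsAutomorphicMeasure μ₁]

/-- **Corollaire (i)(a) for `GL_n × GL_1`, one-family form, from the entire-standard statement at
`GL_n`.** Suppose that for every cuspidal `Π` of `GL_n(𝔸_K)` (in `L²(μ)`), every finite `S` and
every Satake family `γ` of `Π` off `S`, `L^S(s, Π)` agrees on `Re s > 1` with an entire function
(`exists_entire_eq_partialStandardL_of_godementJacquet` for `n ≥ 2`). Then for every cuspidal `π`
of `GL_n` and `χ` of `GL_1` there are a finite `S₀`, Satake families `α₀`, `β₀` of `π`, `χ` off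
`S₀` and an entire `E` with `E(s) = L^{S₀}(s, α₀ ⊗ β₀)` for `Re s > 1`: as in
`exists_one_family_datum_of_standard` — Satake families of both (`exists_isSatakeFamilyOf_holds`),
a level `𝔪` of the Hecke character of `χ` (`HeckeCharacter.exists_level`), `S₀` the union of the
two exceptional sets and the support of `𝔪`, and the hypothesis applied to the twist `π ⊗ χ`
(`CuspidalAutomorphicRepGL.twistByChar`, family `χ(ϖ_v) α₀(v)` off `S₀` by
`IsSatakeFamilyOf.twistByChar`), whose partial standard `L`-function is `L^{S₀}(s, α₀ ⊗ β₀)`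
(`partialPairL_eq_partialStandardL_twist`). [cite: ArthurClozelAMS120, Ch. 3 §2 (2.2) and p. 172]
[cite: MoeglinWaldspurger1989, Appendice, Corollaire (i)(a), p. 667] -/
theorem exists_entire_one_family_partialPairL_of_entire_standard
    (hstd : ∀ (Q : CuspidalAutomorphicRepGL n K μ) {S : Set (HeightOneSpectrum (𝓞 K))}
      (_hS : S.Finite) {γ : SatakeFamily K} (_hγ : IsSatakeFamilyOf Q S γ),
      ∃ g : ℂ → ℂ, Differentiable ℂ g ∧ ∀ s : ℂ, 1 < s.re → g s = partialStandardL S γ s)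
    (P : CuspidalAutomorphicRepGL n K μ) (P' : CuspidalAutomorphicRepGL 1 K μ₁) :
    ∃ (S₀ : Set (HeightOneSpectrum (𝓞 K))) (α₀ β₀ : SatakeFamily K), S₀.Finite ∧
      IsSatakeFamilyOf P S₀ α₀ ∧ IsSatakeFamilyOf P' S₀ β₀ ∧
      ∃ E : ℂ → ℂ, Differentiable ℂ E ∧ ∀ s : ℂ, 1 < s.re → E s = partialPairL S₀ α₀ β₀ s := by
  classical
  obtain ⟨S₁, α, -, hα⟩ := exists_isSatakeFamilyOf_holds (n := n) (K := K) (μ := μ) P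
  obtain ⟨S₂, β, -, hβ⟩ := exists_isSatakeFamilyOf_holds (n := 1) (K := K) (μ := μ₁) P'
  obtain ⟨𝔪, h𝔪, hχ𝔪⟩ := P'.heckeCharacter.exists_level n
  have hT : {v : HeightOneSpectrum (𝓞 K) | v.asIdeal ∣ 𝔪}.Finite := Ideal.finite_factors h𝔪
  set S₀ : Set (HeightOneSpectrum (𝓞 K)) :=
    (↑S₁ ∪ ↑S₂) ∪ {v : HeightOneSpectrum (𝓞 K) | v.asIdeal ∣ 𝔪} with hS₀_def
  have hS₀ : S₀.Finite := (S₁.finite_toSet.union S₂.finite_toSet).union hT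
  have hα₀ : IsSatakeFamilyOf P S₀ α :=
    hα.mono (Set.subset_union_left.trans Set.subset_union_left)
  have hβ₀ : IsSatakeFamilyOf P' S₀ β :=
    hβ.mono (Set.subset_union_right.trans Set.subset_union_left)
  -- the twist `π ⊗ χ` and its Satake family `χ(ϖ_v) α(v)` off `S₀`
  have hγ := hα₀.twistByChar P'.heckeCharacter P'.isUnitary_heckeCharacter
    P'.heckeCharacter_posRealIdele h𝔪 hχ𝔪 (fun v hv hdvd => hv (Set.mem_union_right _ hdvd))
  obtain ⟨E, hE, hEeq⟩ := hstd _ hS₀ hγ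
  refine ⟨S₀, α, β, hS₀, hα₀, hβ₀, E, hE, fun s hs => ?_⟩
  rw [partialPairL_eq_partialStandardL_twist hβ₀ α]
  exact hEeq s hs

end Datum

/-! ### (2.2) at `s = 1` for `GL_n × GL_1` and `GL_1 × GL_n` -/

section RankOne

variable {n : ℕ} {K : Type} [Field K] [NumberField K]
  {μ : Measure (gl n K).automorphicQuotient} [(gl n K).IsAutomorphicMeasure μ]
  {μ₁ : Measure (gl 1 K).automorphicQuotient} [(gl 1 K).IsAutomorphicMeasure μ₁]

/-- **`GL_n × GL_1` from the entire-standard statement at `GL_n` and Mœglin–Waldspurger (ii) at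
`GL_n`.** If every `L^S(s, Π)`, `Π` cuspidal on `GL_n`, agrees on `Re s > 1` with an entire
function, and `MoeglinWaldspurger1989_partialPairL_of_eq_conj` holds at rank `n`
(`s (s - 1) L^S(s, Π ⊗ Π̃)` entire), then the named fact holds for the ranks `(n, 1)`: for each pair
`(π, χ)` the entire one-family datum `E = L^{S₀}(s, α₀ ⊗ β₀)`
(`exists_entire_one_family_partialPairL_of_entire_standard`) has `E(1) ≠ 0` by de la Vallée
Poussin's positivity argument with Landau's lemma (`partialPairL_continuation_apply_one_ne_zero`;
Corollaire (ii) at rank `1` is the theorem `MoeglinWaldspurger1989_partialPairL_of_eq_conj_one`),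
so `L^{S₀}(s, α₀ ⊗ β₀) → E(1) ≠ 0`, and for `m = 1 ≤ 2` the fact is its one-family datum
(`JacquetShalika1981_partialPairL_at_one_of_rank_ne_of_one_family_of_le_two_right`).
[cite: ArthurClozelAMS120, Ch. 3 §2 (2.2)]
[cite: MoeglinWaldspurger1989, Appendice, Corollaire (ii), p. 667]
[cite: Gelbart2007Nonvanishing, §2] -/
theorem JacquetShalika1981_partialPairL_at_one_of_rank_ne_of_entire_standard_of_MW
    (hstd : ∀ (Q : CuspidalAutomorphicRepGL n K μ) {S : Set (HeightOneSpectrum (𝓞 K))}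
      (_hS : S.Finite) {γ : SatakeFamily K} (_hγ : IsSatakeFamilyOf Q S γ),
      ∃ g : ℂ → ℂ, Differentiable ℂ g ∧ ∀ s : ℂ, 1 < s.re → g s = partialStandardL S γ s)
    (hMW : MoeglinWaldspurger1989_partialPairL_of_eq_conj (n := n) (K := K) (μ := μ)) :
    JacquetShalika1981_partialPairL_at_one_of_rank_ne (n := n) (m := 1) (K := K) (μ := μ)
      (μ' := μ₁) := by
  refine JacquetShalika1981_partialPairL_at_one_of_rank_ne_of_one_family_of_le_two_right
    (by norm_num) fun _ hn hm P P' => ?_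
  obtain ⟨S₀, α₀, β₀, hS₀, hα₀, hβ₀, E, hE, hEeq⟩ :=
    exists_entire_one_family_partialPairL_of_entire_standard hstd P P'
  obtain ⟨G, hG, hGeq⟩ := hMW hn P P.conj (P.conj_conj).symm hS₀ hα₀ hα₀.conj
  obtain ⟨G', hG', hG'eq⟩ :=
    MoeglinWaldspurger1989_partialPairL_of_eq_conj_one (K := K) (μ := μ₁) hm P'.conj P' rfl hS₀
      hβ₀.conj hβ₀
  have h1 : E 1 ≠ 0 :=
    partialPairL_continuation_apply_one_ne_zero hn hm P P' hS₀ hα₀ hβ₀ hE hEeq hG hGeq hG' hG'eq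
  refine ⟨S₀, α₀, β₀, hS₀, hα₀, hβ₀, E 1, h1, ?_⟩
  have hc : Tendsto E (𝓝[{s : ℂ | 1 < s.re}] 1) (𝓝 (E 1)) :=
    (hE 1).continuousAt.tendsto.mono_left nhdsWithin_le_nhds
  exact hc.congr' (by filter_upwards [self_mem_nhdsWithin] with s hs using hEeq s hs)

/-- **`GL_1 × GL_n`** from the same two inputs at `GL_n` (by the symmetry
`JacquetShalika1981_partialPairL_at_one_of_rank_ne_symm`). [cite: ArthurClozelAMS120, Ch. 3 §2 (2.2)]
[cite: MoeglinWaldspurger1989, Appendice, Corollaire (ii), p. 667] -/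
theorem JacquetShalika1981_partialPairL_at_one_of_rank_ne_left_of_entire_standard_of_MW
    (hstd : ∀ (Q : CuspidalAutomorphicRepGL n K μ) {S : Set (HeightOneSpectrum (𝓞 K))}
      (_hS : S.Finite) {γ : SatakeFamily K} (_hγ : IsSatakeFamilyOf Q S γ),
      ∃ g : ℂ → ℂ, Differentiable ℂ g ∧ ∀ s : ℂ, 1 < s.re → g s = partialStandardL S γ s)
    (hMW : MoeglinWaldspurger1989_partialPairL_of_eq_conj (n := n) (K := K) (μ := μ)) :
    JacquetShalika1981_partialPairL_at_one_of_rank_ne (n := 1) (m := n) (K := K) (μ := μ₁)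
      (μ' := μ) :=
  JacquetShalika1981_partialPairL_at_one_of_rank_ne_symm
    (JacquetShalika1981_partialPairL_at_one_of_rank_ne_of_entire_standard_of_MW hstd hMW)

/-- **`GL_n × GL_1` and `GL_1 × GL_n`, `n ≥ 2`, from the named facts `godementJacquet` at `GL_n`
(Godement–Jacquet, Thm. 13.8: `L(s, Π)` entire for cuspidal `Π` of `GL_n`, `n ≥ 2`) and
`MoeglinWaldspurger1989_partialPairL_of_eq_conj` at `GL_n` (Corollaire (ii):
`s (s - 1) L^S(s, Π ⊗ Π̃)` entire), and nothing else** — the entire-standard statement is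
`exists_entire_eq_partialStandardL_of_godementJacquet`. So Arthur–Clozel's (2.2) at `s₀ = 1` for
the pairs `(π, χ)`, `(χ, π)` needs neither Shahidi's Eisenstein-series non-vanishing on `GL_{n+1}`
nor Jacquet–Shalika's (1976) `L(1, Π) ≠ 0`. [cite: ArthurClozelAMS120, Ch. 3 §2 (2.2)]
[cite: GodementJacquet1972, Thm. 13.8]
[cite: MoeglinWaldspurger1989, Appendice, Corollaire (ii), p. 667]
[cite: Gelbart2007Nonvanishing, §2] -/
theorem JacquetShalika1981_partialPairL_at_one_of_rank_ne_and_left_of_godementJacquet_of_MW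
    (hn : 2 ≤ n) (hGJ : godementJacquet (n := n) (K := K) (μ := μ))
    (hMW : MoeglinWaldspurger1989_partialPairL_of_eq_conj (n := n) (K := K) (μ := μ)) :
    JacquetShalika1981_partialPairL_at_one_of_rank_ne (n := n) (m := 1) (K := K) (μ := μ)
        (μ' := μ₁) ∧
      JacquetShalika1981_partialPairL_at_one_of_rank_ne (n := 1) (m := n) (K := K) (μ := μ₁)
        (μ' := μ) :=
  ⟨JacquetShalika1981_partialPairL_at_one_of_rank_ne_of_entire_standard_of_MW
      (fun Q _ hS _ hγ => exists_entire_eq_partialStandardL_of_godementJacquet hn hGJ Q hS hγ) hMW,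
    JacquetShalika1981_partialPairL_at_one_of_rank_ne_left_of_entire_standard_of_MW
      (fun Q _ hS _ hγ => exists_entire_eq_partialStandardL_of_godementJacquet hn hGJ Q hS hγ) hMW⟩

end RankOne

end Literature.NumberTheory.Automorphic

end
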